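import Summits.HodgeConjecture.HodgeConjecture.Theorems.Ring2WeilCoverageWeilGramLevel28Principal
import Summits.HodgeConjecture.HodgeConjecture.Theorems.Ring2WeilCoverageWeilGramSign
import HarnessLib

/-!
# Weil-type family coverage — THE COMPONENTS OF THE WEIL-TYPE `ℤ[ζ₂₈]`-SIXFOLDS, III: `K_d = ℚ(√−7)`
# (`s₇ = 1 + 2(ζ⁴ + ζ⁸ + ζ¹⁶)`, the Gauss sum of `ζ₇ = ζ⁴`): principal-type Gram determinant `+21952 = 7·56²` — the
# WRONG sign: NO principal-type `E_ζ′` is `Φ`-positive on a `ℚ(√−7)`-Weil-type CM type (census NO row `(28, ℚ(√−7))`)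

research route conditional on HC_CM; not a corollary; Q11.4-sentence-2 already refuted in dim ≥ 3.

Ring 2, WEIL-TYPE FAMILY-COVERAGE CENSUS (`HOME/WEIL-FAMILY-COVERAGE.md` `## b01`, blocks b01.34/b01.36 (the NO row
`(ℚ(ζ₂₈), √−7)`: `not_exists_principal_twentyEight`), b01.41 (C) «on all NO rows the principal `ξ` gives `a = −1`
(wrong sign)», S-pencil there), part 106 of the `Ring2WeilCoverage*` series; continues parts 104/105.

* §0 `s₇` is skew with `s₇² = −7`.
* §1 `(E_ξ, s₇)`: eleven traces, **`det a = 21952 = 7·56² > 0`**.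
* §2 **EVERY skew principal-type `ζ′` gives `21952`** (THEOREM L (i) at `28`); §3 **NO such `ζ′` is `Φ`-positive on a
  CM type of `s₇`-signature `(3,3)`** (`(−1)³·21952 < 0`, part 92) — the census verdict `not_exists_principal_twentyEight`
  (unit signatures) RE-DERIVED from van Geemen's sign.  Parts 107/108: the types `𝔮₇` (split) and `(2 + √7)` (→ R4).

HONEST FRAMING as parts 104/105; `HC_CM` is used nowhere.  No `def`, no named fact, no `sorry`.  Certificates from
`work/py/gen6.py` + `lev28.py`, re-verified by `linear_combination`.

References: [cite: vanGeemen1994HodgeAV, Lemma 5.2 (2)–(4), 5.4 and (5.4.1)]; [cite: Shimura1998, §14.3 Prop. 4–5,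
pp. 103–104]; census b01.34, b01.36, b01.41 (C) (seat-derived).
-/

noncomputable section

open Polynomial NumberField Module
open scoped nonZeroDivisors

namespace Summit.HodgeConjecture.Ring2WeilCoverage.WeilGramLevel28SqrtNegSeven

open Literature.AlgebraicGeometry.VanGeemen1994 (weilField weilNormResidueGroup)
open Literature.AlgebraicGeometry.Motives (CMType normUnitsSubgroup)
open Literature.NumberTheory.ComplexMultiplication
open Summit.HodgeConjecture.Ring2WeilCoverage.TraceGramDeterminant (trace_aeval_zeta_mul_inv)
open Summit.HodgeConjecture.Ring2WeilCoverage.WeilGramCMPoint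
open Summit.HodgeConjecture.Ring2WeilCoverage.RealUnitNormHalfSystems (complexConj_eq_inv)
open Summit.HodgeConjecture.Ring2WeilCoverage.CyclotomicPrincipalObstruction (complexConj_xi)
open Summit.HodgeConjecture.Ring2WeilCoverage.CyclotomicDifferent (isOfType_one_xi_top xi_ne_zero)
open Summit.HodgeConjecture.HodgeConjecture.Ring2.WeilCoverage (mk_neg_eq_split_of_odd mk_neg_ne_split_of_odd
  mem_normUnitsSubgroup_of_sq_add_mul_sq)
open Summit.HodgeConjecture.HodgeConjecture.Ring2.Hypotheses (splitDiscriminantClass)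
open Summit.HodgeConjecture.Ring2WeilCoverage.WeilGramLevel28
open Summit.HodgeConjecture.Ring2WeilCoverage.WeilGramLevel28Principal
open Summit.HodgeConjecture.Ring2WeilCoverage.WeilGramSign (not_pos_of_neg_one_pow_mul_det_nonpos)
open Summit.HodgeConjecture.Ring2WeilCoverage.CyclotomicUnconditional (norm_realUnits_pos_twentyEight)
variable {K : Type} [Field K] [NumberField K] {ζ : K}

/-! ### §0 `s₇ = 1 + 2(ζ⁴ + ζ⁸ + ζ¹⁶)` -/

omit [NumberField K] in
/-- **`(1 + 2(ζ⁴ + ζ⁸ + ζ¹⁶))² = −7`**: `s = √−7 = 1 + 2(ζ⁴ + ζ⁸ + ζ¹⁶)` generates `K_d = ℚ(√−7) ⊂ ℚ(ζ_28)`. [folklore] -/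
theorem sq_sqrtNegSeven (hζ : IsPrimitiveRoot ζ 28) : (1 + 2 * (ζ ^ 4 + ζ ^ 8 + ζ ^ 16)) ^ 2 = -7 := by
  have h28 : ζ ^ 28 = 1 := hζ.pow_eq_one
  linear_combination (8 + 8 * ζ^2 + 8 * ζ^4 + 8 * ζ^6 + 8 * ζ^8 + 8 * ζ^10 + 8 * ζ^12) * cyc_twentyEight hζ +
    (4 * ζ^4) * h28

/-- **`s = √−7 = 1 + 2(ζ⁴ + ζ⁸ + ζ¹⁶)` is skew** (`s^ρ = −s`). [folklore] -/
theorem complexConj_sqrtNegSeven [IsCMField K] (hζ : IsPrimitiveRoot ζ 28) :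
    IsCMField.complexConj K (1 + 2 * (ζ ^ 4 + ζ ^ 8 + ζ ^ 16)) = -(1 + 2 * (ζ ^ 4 + ζ ^ 8 + ζ ^ 16)) := by
  simp only [map_add, map_mul, map_pow, map_one, map_ofNat, complexConj_eq_inv hζ]
  rw [inv_pow_eq_pow hζ (show 4 + 24 = 28 by norm_num), inv_pow_eq_pow hζ (show 8 + 20 = 28 by norm_num), inv_pow_eq_pow hζ (show 16 + 12 = 28 by norm_num)]
  linear_combination (2 + 2 * ζ^2 + 2 * ζ^4 + 2 * ζ^6 + 2 * ζ^8 + 2 * ζ^10 + 2 * ζ^12) * cyc_twentyEight hζ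

/-! ### §1 The principal-type form `(E_ξ, s₇)`: `det a = 21952` -/

/-- `Tr(ζ′sθ^0) = 2` for `ζ′ = ξ = ζ⁵/Φ₂₈′(ζ)`, `s = √−7 = 1 + 2(ζ⁴ + ζ⁸ + ζ¹⁶)`, `θ = ζ + ζ⁻¹` (Euler evaluation). research route conditional on HC_CM; not a corollary; Q11.4-sentence-2 already refuted in dim ≥ 3. [folklore] -/
theorem trace_xi_sqrtNegSeven_zero [IsCyclotomicExtension {28} ℚ K] (hζ : IsPrimitiveRoot ζ 28) :
    Algebra.trace ℚ K ((ζ ^ 5 * (aeval ζ (derivative (cyclotomic 28 ℚ)))⁻¹) * (1 + 2 * (ζ ^ 4 + ζ ^ 8 + ζ ^ 16))) = 2 := by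
  have hΦ := cyc_twentyEight hζ
  rw [trace_of_key₀ hζ (C (0 : ℚ) + C (-2 : ℚ) * X + C (0 : ℚ) * X ^ 2 + C (2 : ℚ) * X ^ 3 + C (0 : ℚ) * X ^ 4 +
      C (-1 : ℚ) * X ^ 5 + C (0 : ℚ) * X ^ 6 + C (0 : ℚ) * X ^ 7 + C (0 : ℚ) * X ^ 8 + C (0 : ℚ) * X ^ 9 +
      C (0 : ℚ) * X ^ 10 + C (2 : ℚ) * X ^ 11) (by compute_degree) (by
    simp only [map_add, map_mul, map_pow, aeval_C, aeval_X, eq_ratCast]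
    push_cast
    linear_combination ((aeval ζ (derivative (cyclotomic 28 ℚ)))⁻¹ * (2 * ζ + 2 * ζ^7 + 2 * ζ^9)) * hΦ)]
  norm_num [coeff_X_pow, coeff_X, coeff_C, coeff_one]

/-- `Tr(ζ′sθ^1) = 0` for `ζ′ = ξ = ζ⁵/Φ₂₈′(ζ)`, `s = √−7 = 1 + 2(ζ⁴ + ζ⁸ + ζ¹⁶)`, `θ = ζ + ζ⁻¹` (Euler evaluation). research route conditional on HC_CM; not a corollary; Q11.4-sentence-2 already refuted in dim ≥ 3. [folklore] -/
theorem trace_xi_sqrtNegSeven_one [IsCyclotomicExtension {28} ℚ K] (hζ : IsPrimitiveRoot ζ 28) :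
    Algebra.trace ℚ K ((ζ ^ 5 * (aeval ζ (derivative (cyclotomic 28 ℚ)))⁻¹) * (1 + 2 * (ζ ^ 4 + ζ ^ 8 + ζ ^ 16)) * (ζ + ζ⁻¹)) = 0 := by
  have hΦ := cyc_twentyEight hζ
  rw [trace_of_key₁ hζ (C (-4 : ℚ) + C (0 : ℚ) * X + C (2 : ℚ) * X ^ 2 + C (0 : ℚ) * X ^ 3 + C (-1 : ℚ) * X ^ 4 +
      C (0 : ℚ) * X ^ 5 + C (1 : ℚ) * X ^ 6 + C (0 : ℚ) * X ^ 7 + C (-2 : ℚ) * X ^ 8 + C (0 : ℚ) * X ^ 9 +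
      C (4 : ℚ) * X ^ 10 + C (0 : ℚ) * X ^ 11) (by compute_degree) (by
    simp only [map_add, map_mul, map_pow, aeval_C, aeval_X, eq_ratCast]
    push_cast
    linear_combination ((aeval ζ (derivative (cyclotomic 28 ℚ)))⁻¹ * (4 * ζ + 2 * ζ^3 + 2 * ζ^7 + 4 * ζ^9 + 2 * ζ^11)) * hΦ)]
  norm_num [coeff_X_pow, coeff_X, coeff_C, coeff_one]

/-- `Tr(ζ′sθ^2) = 8` for `ζ′ = ξ = ζ⁵/Φ₂₈′(ζ)`, `s = √−7 = 1 + 2(ζ⁴ + ζ⁸ + ζ¹⁶)`, `θ = ζ + ζ⁻¹` (Euler evaluation). research route conditional on HC_CM; not a corollary; Q11.4-sentence-2 already refuted in dim ≥ 3. [folklore] -/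
theorem trace_xi_sqrtNegSeven_two [IsCyclotomicExtension {28} ℚ K] (hζ : IsPrimitiveRoot ζ 28) :
    Algebra.trace ℚ K ((ζ ^ 5 * (aeval ζ (derivative (cyclotomic 28 ℚ)))⁻¹) * (1 + 2 * (ζ ^ 4 + ζ ^ 8 + ζ ^ 16)) * (ζ + ζ⁻¹) ^ 2) = 8 := by
  have hΦ := cyc_twentyEight hζ
  rw [trace_of_key hζ (C (0 : ℚ) + C (-6 : ℚ) * X + C (0 : ℚ) * X ^ 2 + C (5 : ℚ) * X ^ 3 + C (0 : ℚ) * X ^ 4 +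
      C (-4 : ℚ) * X ^ 5 + C (0 : ℚ) * X ^ 6 + C (3 : ℚ) * X ^ 7 + C (0 : ℚ) * X ^ 8 + C (-2 : ℚ) * X ^ 9 +
      C (0 : ℚ) * X ^ 10 + C (8 : ℚ) * X ^ 11) (by compute_degree) (by
    simp only [map_add, map_mul, map_pow, aeval_C, aeval_X, eq_ratCast]
    push_cast
    linear_combination ((aeval ζ (derivative (cyclotomic 28 ℚ)))⁻¹ * (6 * ζ^3 + 2 * ζ^5 + 2 * ζ^7 + 6 * ζ^9 + 6 * ζ^11 + 2 * ζ^13)) * hΦ)]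
  norm_num [coeff_X_pow, coeff_X, coeff_C, coeff_one]

/-- `Tr(ζ′sθ^3) = 0` for `ζ′ = ξ = ζ⁵/Φ₂₈′(ζ)`, `s = √−7 = 1 + 2(ζ⁴ + ζ⁸ + ζ¹⁶)`, `θ = ζ + ζ⁻¹` (Euler evaluation). research route conditional on HC_CM; not a corollary; Q11.4-sentence-2 already refuted in dim ≥ 3. [folklore] -/
theorem trace_xi_sqrtNegSeven_three [IsCyclotomicExtension {28} ℚ K] (hζ : IsPrimitiveRoot ζ 28) :
    Algebra.trace ℚ K ((ζ ^ 5 * (aeval ζ (derivative (cyclotomic 28 ℚ)))⁻¹) * (1 + 2 * (ζ ^ 4 + ζ ^ 8 + ζ ^ 16)) * (ζ + ζ⁻¹) ^ 3) = 0 := by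
  have hΦ := cyc_twentyEight hζ
  rw [trace_of_key hζ (C (-14 : ℚ) + C (0 : ℚ) * X + C (7 : ℚ) * X ^ 2 + C (0 : ℚ) * X ^ 3 + C (-7 : ℚ) * X ^ 4 +
      C (0 : ℚ) * X ^ 5 + C (7 : ℚ) * X ^ 6 + C (0 : ℚ) * X ^ 7 + C (-7 : ℚ) * X ^ 8 + C (0 : ℚ) * X ^ 9 +
      C (14 : ℚ) * X ^ 10 + C (0 : ℚ) * X ^ 11) (by compute_degree) (by
    simp only [map_add, map_mul, map_pow, aeval_C, aeval_X, eq_ratCast]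
    push_cast
    linear_combination ((aeval ζ (derivative (cyclotomic 28 ℚ)))⁻¹ * (14 * ζ^3 + 8 * ζ^5 + 4 * ζ^7 + 8 * ζ^9 + 12 * ζ^11 + 8 * ζ^13 + 2 * ζ^15)) * hΦ)]
  norm_num [coeff_X_pow, coeff_X, coeff_C, coeff_one]

/-- `Tr(ζ′sθ^4) = 28` for `ζ′ = ξ = ζ⁵/Φ₂₈′(ζ)`, `s = √−7 = 1 + 2(ζ⁴ + ζ⁸ + ζ¹⁶)`, `θ = ζ + ζ⁻¹` (Euler evaluation). research route conditional on HC_CM; not a corollary; Q11.4-sentence-2 already refuted in dim ≥ 3. [folklore] -/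
theorem trace_xi_sqrtNegSeven_four [IsCyclotomicExtension {28} ℚ K] (hζ : IsPrimitiveRoot ζ 28) :
    Algebra.trace ℚ K ((ζ ^ 5 * (aeval ζ (derivative (cyclotomic 28 ℚ)))⁻¹) * (1 + 2 * (ζ ^ 4 + ζ ^ 8 + ζ ^ 16)) * (ζ + ζ⁻¹) ^ 4) = 28 := by
  have h28 : ζ ^ 28 = 1 := hζ.pow_eq_one
  have hΦ := cyc_twentyEight hζ
  rw [trace_of_key hζ (C (0 : ℚ) + C (-21 : ℚ) * X + C (0 : ℚ) * X ^ 2 + C (14 : ℚ) * X ^ 3 + C (0 : ℚ) * X ^ 4 +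
      C (-14 : ℚ) * X ^ 5 + C (0 : ℚ) * X ^ 6 + C (14 : ℚ) * X ^ 7 + C (0 : ℚ) * X ^ 8 + C (-7 : ℚ) * X ^ 9 +
      C (0 : ℚ) * X ^ 10 + C (28 : ℚ) * X ^ 11) (by compute_degree) (by
    simp only [map_add, map_mul, map_pow, aeval_C, aeval_X, eq_ratCast]
    push_cast
    linear_combination ((aeval ζ (derivative (cyclotomic 28 ℚ)))⁻¹ * (2 * ζ + 2 * ζ^3 + 22 * ζ^5 + 12 * ζ^7 + 12 * ζ^9 + 20 * ζ^11 + 20 * ζ^13 +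
        8 * ζ^15)) * hΦ +
      ((aeval ζ (derivative (cyclotomic 28 ℚ)))⁻¹ * (2 * ζ)) * h28)]
  norm_num [coeff_X_pow, coeff_X, coeff_C, coeff_one]

/-- `Tr(ζ′sθ^5) = 0` for `ζ′ = ξ = ζ⁵/Φ₂₈′(ζ)`, `s = √−7 = 1 + 2(ζ⁴ + ζ⁸ + ζ¹⁶)`, `θ = ζ + ζ⁻¹` (Euler evaluation). research route conditional on HC_CM; not a corollary; Q11.4-sentence-2 already refuted in dim ≥ 3. [folklore] -/
theorem trace_xi_sqrtNegSeven_five [IsCyclotomicExtension {28} ℚ K] (hζ : IsPrimitiveRoot ζ 28) :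
    Algebra.trace ℚ K ((ζ ^ 5 * (aeval ζ (derivative (cyclotomic 28 ℚ)))⁻¹) * (1 + 2 * (ζ ^ 4 + ζ ^ 8 + ζ ^ 16)) * (ζ + ζ⁻¹) ^ 5) = 0 := by
  have h28 : ζ ^ 28 = 1 := hζ.pow_eq_one
  have hΦ := cyc_twentyEight hζ
  rw [trace_of_key hζ (C (-49 : ℚ) + C (0 : ℚ) * X + C (21 : ℚ) * X ^ 2 + C (0 : ℚ) * X ^ 3 + C (-28 : ℚ) * X ^ 4 +
      C (0 : ℚ) * X ^ 5 + C (28 : ℚ) * X ^ 6 + C (0 : ℚ) * X ^ 7 + C (-21 : ℚ) * X ^ 8 + C (0 : ℚ) * X ^ 9 +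
      C (49 : ℚ) * X ^ 10 + C (0 : ℚ) * X ^ 11) (by compute_degree) (by
    simp only [map_add, map_mul, map_pow, aeval_C, aeval_X, eq_ratCast]
    push_cast
    linear_combination ((aeval ζ (derivative (cyclotomic 28 ℚ)))⁻¹ * (10 * ζ + 12 * ζ^3 + 52 * ζ^5 + 34 * ζ^7 + 24 * ζ^9 + 32 * ζ^11 +
        40 * ζ^13 + 20 * ζ^15)) * hΦ +
      ((aeval ζ (derivative (cyclotomic 28 ℚ)))⁻¹ * (10 * ζ + 2 * ζ^3)) * h28)]
  norm_num [coeff_X_pow, coeff_X, coeff_C, coeff_one]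

/-- `Tr(ζ′sθ^6) = 98` for `ζ′ = ξ = ζ⁵/Φ₂₈′(ζ)`, `s = √−7 = 1 + 2(ζ⁴ + ζ⁸ + ζ¹⁶)`, `θ = ζ + ζ⁻¹` (Euler evaluation). research route conditional on HC_CM; not a corollary; Q11.4-sentence-2 already refuted in dim ≥ 3. [folklore] -/
theorem trace_xi_sqrtNegSeven_six [IsCyclotomicExtension {28} ℚ K] (hζ : IsPrimitiveRoot ζ 28) :
    Algebra.trace ℚ K ((ζ ^ 5 * (aeval ζ (derivative (cyclotomic 28 ℚ)))⁻¹) * (1 + 2 * (ζ ^ 4 + ζ ^ 8 + ζ ^ 16)) * (ζ + ζ⁻¹) ^ 6) = 98 := by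
  have h28 : ζ ^ 28 = 1 := hζ.pow_eq_one
  have hΦ := cyc_twentyEight hζ
  rw [trace_of_key hζ (C (0 : ℚ) + C (-77 : ℚ) * X + C (0 : ℚ) * X ^ 2 + C (42 : ℚ) * X ^ 3 + C (0 : ℚ) * X ^ 4 +
      C (-49 : ℚ) * X ^ 5 + C (0 : ℚ) * X ^ 6 + C (56 : ℚ) * X ^ 7 + C (0 : ℚ) * X ^ 8 + C (-21 : ℚ) * X ^ 9 +
      C (0 : ℚ) * X ^ 10 + C (98 : ℚ) * X ^ 11) (by compute_degree) (by
    simp only [map_add, map_mul, map_pow, aeval_C, aeval_X, eq_ratCast]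
    push_cast
    linear_combination ((aeval ζ (derivative (cyclotomic 28 ℚ)))⁻¹ * (30 * ζ + 42 * ζ^3 + 15 * ζ^5 + 86 * ζ^7 + 58 * ζ^9 + 56 * ζ^11 +
        72 * ζ^13 + 40 * ζ^15)) * hΦ +
      ((aeval ζ (derivative (cyclotomic 28 ℚ)))⁻¹ * (30 * ζ + 12 * ζ^3 + 2 * ζ^5)) * h28)]
  norm_num [coeff_X_pow, coeff_X, coeff_C, coeff_one]

/-- `Tr(ζ′sθ^7) = 0` for `ζ′ = ξ = ζ⁵/Φ₂₈′(ζ)`, `s = √−7 = 1 + 2(ζ⁴ + ζ⁸ + ζ¹⁶)`, `θ = ζ + ζ⁻¹` (Euler evaluation). research route conditional on HC_CM; not a corollary; Q11.4-sentence-2 already refuted in dim ≥ 3. [folklore] -/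
theorem trace_xi_sqrtNegSeven_seven [IsCyclotomicExtension {28} ℚ K] (hζ : IsPrimitiveRoot ζ 28) :
    Algebra.trace ℚ K ((ζ ^ 5 * (aeval ζ (derivative (cyclotomic 28 ℚ)))⁻¹) * (1 + 2 * (ζ ^ 4 + ζ ^ 8 + ζ ^ 16)) * (ζ + ζ⁻¹) ^ 7) = 0 := by
  have h28 : ζ ^ 28 = 1 := hζ.pow_eq_one
  have hΦ := cyc_twentyEight hζ
  rw [trace_of_key hζ (C (-175 : ℚ) + C (0 : ℚ) * X + C (63 : ℚ) * X ^ 2 + C (0 : ℚ) * X ^ 3 + C (-105 : ℚ) * X ^ 4 +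
      C (0 : ℚ) * X ^ 5 + C (105 : ℚ) * X ^ 6 + C (0 : ℚ) * X ^ 7 + C (-63 : ℚ) * X ^ 8 + C (0 : ℚ) * X ^ 9 +
      C (175 : ℚ) * X ^ 10 + C (0 : ℚ) * X ^ 11) (by compute_degree) (by
    simp only [map_add, map_mul, map_pow, aeval_C, aeval_X, eq_ratCast]
    push_cast
    linear_combination ((aeval ζ (derivative (cyclotomic 28 ℚ)))⁻¹ * (70 * ζ + 112 * ζ^3 + 57 * ζ^5 + 199 * ζ^7 + 144 * ζ^9 + 114 * ζ^11 +
        128 * ζ^13 + 72 * ζ^15)) * hΦ +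
      ((aeval ζ (derivative (cyclotomic 28 ℚ)))⁻¹ * (70 * ζ + 42 * ζ^3 + 14 * ζ^5 + 2 * ζ^7)) * h28)]
  norm_num [coeff_X_pow, coeff_X, coeff_C, coeff_one]

/-- `Tr(ζ′sθ^8) = 350` for `ζ′ = ξ = ζ⁵/Φ₂₈′(ζ)`, `s = √−7 = 1 + 2(ζ⁴ + ζ⁸ + ζ¹⁶)`, `θ = ζ + ζ⁻¹` (Euler evaluation). research route conditional on HC_CM; not a corollary; Q11.4-sentence-2 already refuted in dim ≥ 3. [folklore] -/
theorem trace_xi_sqrtNegSeven_eight [IsCyclotomicExtension {28} ℚ K] (hζ : IsPrimitiveRoot ζ 28) :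
    Algebra.trace ℚ K ((ζ ^ 5 * (aeval ζ (derivative (cyclotomic 28 ℚ)))⁻¹) * (1 + 2 * (ζ ^ 4 + ζ ^ 8 + ζ ^ 16)) * (ζ + ζ⁻¹) ^ 8) = 350 := by
  have h28 : ζ ^ 28 = 1 := hζ.pow_eq_one
  have hΦ := cyc_twentyEight hζ
  rw [trace_of_key hζ (C (0 : ℚ) + C (-287 : ℚ) * X + C (0 : ℚ) * X ^ 2 + C (133 : ℚ) * X ^ 3 + C (0 : ℚ) * X ^ 4 +
      C (-175 : ℚ) * X ^ 5 + C (0 : ℚ) * X ^ 6 + C (217 : ℚ) * X ^ 7 + C (0 : ℚ) * X ^ 8 + C (-63 : ℚ) * X ^ 9 +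
      C (0 : ℚ) * X ^ 10 + C (350 : ℚ) * X ^ 11) (by compute_degree) (by
    simp only [map_add, map_mul, map_pow, aeval_C, aeval_X, eq_ratCast]
    push_cast
    linear_combination ((aeval ζ (derivative (cyclotomic 28 ℚ)))⁻¹ * (142 * ζ + 254 * ζ^3 + 169 * ζ^5 + 81 * ζ^7 + 343 * ζ^9 + 258 * ζ^11 +
        242 * ζ^13 + 128 * ζ^15)) * hΦ +
      ((aeval ζ (derivative (cyclotomic 28 ℚ)))⁻¹ * (142 * ζ + 112 * ζ^3 + 56 * ζ^5 + 16 * ζ^7 + 2 * ζ^9)) * h28)]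
  norm_num [coeff_X_pow, coeff_X, coeff_C, coeff_one]

/-- `Tr(ζ′sθ^9) = 0` for `ζ′ = ξ = ζ⁵/Φ₂₈′(ζ)`, `s = √−7 = 1 + 2(ζ⁴ + ζ⁸ + ζ¹⁶)`, `θ = ζ + ζ⁻¹` (Euler evaluation). research route conditional on HC_CM; not a corollary; Q11.4-sentence-2 already refuted in dim ≥ 3. [folklore] -/
theorem trace_xi_sqrtNegSeven_nine [IsCyclotomicExtension {28} ℚ K] (hζ : IsPrimitiveRoot ζ 28) :
    Algebra.trace ℚ K ((ζ ^ 5 * (aeval ζ (derivative (cyclotomic 28 ℚ)))⁻¹) * (1 + 2 * (ζ ^ 4 + ζ ^ 8 + ζ ^ 16)) * (ζ + ζ⁻¹) ^ 9) = 0 := by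
  have h28 : ζ ^ 28 = 1 := hζ.pow_eq_one
  have hΦ := cyc_twentyEight hζ
  rw [trace_of_key hζ (C (-637 : ℚ) + C (0 : ℚ) * X + C (196 : ℚ) * X ^ 2 + C (0 : ℚ) * X ^ 3 + C (-392 : ℚ) * X ^ 4 +
      C (0 : ℚ) * X ^ 5 + C (392 : ℚ) * X ^ 6 + C (0 : ℚ) * X ^ 7 + C (-196 : ℚ) * X ^ 8 + C (0 : ℚ) * X ^ 9 +
      C (637 : ℚ) * X ^ 10 + C (0 : ℚ) * X ^ 11) (by compute_degree) (by
    simp only [map_add, map_mul, map_pow, aeval_C, aeval_X, eq_ratCast]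
    push_cast
    linear_combination ((aeval ζ (derivative (cyclotomic 28 ℚ)))⁻¹ * (270 * ζ + 524 * ζ^3 + 423 * ζ^5 + 250 * ζ^7 + 774 * ζ^9 + 601 * ζ^11 +
        500 * ζ^13 + 242 * ζ^15)) * hΦ +
      ((aeval ζ (derivative (cyclotomic 28 ℚ)))⁻¹ * (270 * ζ + 254 * ζ^3 + 168 * ζ^5 + 72 * ζ^7 + 18 * ζ^9 + 2 * ζ^11)) * h28)]
  norm_num [coeff_X_pow, coeff_X, coeff_C, coeff_one]

/-- `Tr(ζ′sθ^10) = 1274` for `ζ′ = ξ = ζ⁵/Φ₂₈′(ζ)`, `s = √−7 = 1 + 2(ζ⁴ + ζ⁸ + ζ¹⁶)`, `θ = ζ + ζ⁻¹` (Euler evaluation). research route conditional on HC_CM; not a corollary; Q11.4-sentence-2 already refuted in dim ≥ 3. [folklore] -/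
theorem trace_xi_sqrtNegSeven_ten [IsCyclotomicExtension {28} ℚ K] (hζ : IsPrimitiveRoot ζ 28) :
    Algebra.trace ℚ K ((ζ ^ 5 * (aeval ζ (derivative (cyclotomic 28 ℚ)))⁻¹) * (1 + 2 * (ζ ^ 4 + ζ ^ 8 + ζ ^ 16)) * (ζ + ζ⁻¹) ^ 10) = 1274 := by
  have h28 : ζ ^ 28 = 1 := hζ.pow_eq_one
  have hΦ := cyc_twentyEight hζ
  rw [trace_of_key hζ (C (0 : ℚ) + C (-1078 : ℚ) * X + C (0 : ℚ) * X ^ 2 + C (441 : ℚ) * X ^ 3 + C (0 : ℚ) * X ^ 4 +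
      C (-637 : ℚ) * X ^ 5 + C (0 : ℚ) * X ^ 6 + C (833 : ℚ) * X ^ 7 + C (0 : ℚ) * X ^ 8 + C (-196 : ℚ) * X ^ 9 +
      C (0 : ℚ) * X ^ 10 + C (1274 : ℚ) * X ^ 11) (by compute_degree) (by
    simp only [map_add, map_mul, map_pow, aeval_C, aeval_X, eq_ratCast]
    push_cast
    linear_combination ((aeval ζ (derivative (cyclotomic 28 ℚ)))⁻¹ * (512 * ζ + 1036 * ζ^3 + 947 * ζ^5 + 673 * ζ^7 + 387 * ζ^9 + 1375 * ζ^11 +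
        1101 * ζ^13 + 500 * ζ^15)) * hΦ +
      ((aeval ζ (derivative (cyclotomic 28 ℚ)))⁻¹ * (512 * ζ + 524 * ζ^3 + 422 * ζ^5 + 240 * ζ^7 + 90 * ζ^9 + 20 * ζ^11 +
        2 * ζ^13)) * h28)]
  norm_num [coeff_X_pow, coeff_X, coeff_C, coeff_one]

/-- **The Gram datum `a` of `(E_ζ′, s)` in the real frame `θ^i` (`i < 6`)** for `ζ′ = ξ = ζ⁵/Φ₂₈′(ζ)` (principal type (1)),
`s = √−7 = 1 + 2(ζ⁴ + ζ⁸ + ζ¹⁶)`: the integer Hankel matrix `(−Tr(ζ′sθ^{i+j}))ᵢⱼ` (and `b = 0`, part 82 `hb_eq_zero`).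
research route conditional on HC_CM; not a corollary; Q11.4-sentence-2 already refuted in dim ≥ 3. [cite: vanGeemen1994HodgeAV, Lemma 5.2 (2)–(3)] -/
theorem realPart_xi_sqrtNegSeven [IsCyclotomicExtension {28} ℚ K] [IsCMField K] (hζ : IsPrimitiveRoot ζ 28)
    {x : Fin 6 → K} (hx : ∀ i, x i = (ζ + ζ⁻¹) ^ (i : ℕ)) {a : Matrix (Fin 6) (Fin 6) ℚ}
    (ha : ∀ i j, a i j = Algebra.trace ℚ K ((ζ ^ 5 * (aeval ζ (derivative (cyclotomic 28 ℚ)))⁻¹) * x i * IsCMField.complexConj K ((1 + 2 * (ζ ^ 4 + ζ ^ 8 + ζ ^ 16)) * x j))) :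
    a = !![-2, 0, -8, 0, -28, 0; 0, -8, 0, -28, 0, -98; -8, 0, -28, 0, -98, 0; 0, -28, 0, -98, 0, -350; -28, 0, -98, 0, -350, 0; 0, -98, 0, -350, 0, -1274] := by
  rw [ha_eq (complexConj_sqrtNegSeven hζ) (complexConj_thetaFrame hζ hx) ha]
  ext i j
  simp only [Matrix.of_apply, hx, ← pow_add]
  fin_cases i <;> fin_cases j <;> simp [trace_xi_sqrtNegSeven_zero hζ, trace_xi_sqrtNegSeven_one hζ, trace_xi_sqrtNegSeven_two hζ, trace_xi_sqrtNegSeven_three hζ, trace_xi_sqrtNegSeven_four hζ, trace_xi_sqrtNegSeven_five hζ,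
    trace_xi_sqrtNegSeven_six hζ, trace_xi_sqrtNegSeven_seven hζ, trace_xi_sqrtNegSeven_eight hζ, trace_xi_sqrtNegSeven_nine hζ, trace_xi_sqrtNegSeven_ten hζ]

/-- **`det a = 21952`** for `ζ′ = ξ = ζ⁵/Φ₂₈′(ζ)`, `s = √−7 = 1 + 2(ζ⁴ + ζ⁸ + ζ¹⁶)` (frame `θ^i`, `i < 6`). research route conditional on HC_CM; not a corollary; Q11.4-sentence-2 already refuted in dim ≥ 3. [cite: vanGeemen1994HodgeAV, Lemma 5.2 (3)] -/
theorem det_realPart_xi_sqrtNegSeven [IsCyclotomicExtension {28} ℚ K] [IsCMField K] (hζ : IsPrimitiveRoot ζ 28)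
    {x : Fin 6 → K} (hx : ∀ i, x i = (ζ + ζ⁻¹) ^ (i : ℕ)) {a : Matrix (Fin 6) (Fin 6) ℚ}
    (ha : ∀ i j, a i j = Algebra.trace ℚ K ((ζ ^ 5 * (aeval ζ (derivative (cyclotomic 28 ℚ)))⁻¹) * x i * IsCMField.complexConj K ((1 + 2 * (ζ ^ 4 + ζ ^ 8 + ζ ^ 16)) * x j))) :
    a.det = 21952 := by
  rw [realPart_xi_sqrtNegSeven hζ hx ha]
  simp [Matrix.det_succ_row_zero, Fin.sum_univ_succ, Fin.succAbove, Matrix.submatrix]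
  norm_num

/-! ### §2 Invariance; §3 the NO row `(28, ℚ(√−7))` from the sign of `det H` -/

/-- **For EVERY skew `ζ′` of PRINCIPAL type on `ℤ[ζ_28]` (`IsOfType 1 ζ′ ⊤`; `ζ′ = uξ`, `u` a real unit, `N(u) = 1`
by THEOREM L (i) at `28`) the Gram determinant of `(E_ζ′, s₇)` in the frame `θ^i` is `21952`** (such `ζ′` exist for SOME `Φ`, but — below — for no `ℚ(√−7)`-Weil-type `Φ`): the census NO row `(28, ℚ(√−7))`;
`(−1)³ det a < 0`: the WRONG sign for Weil signature `(3,3)` [vG94 5.2 (4)] — see the NO-row theorem below.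
research route conditional on HC_CM; not a corollary; Q11.4-sentence-2 already refuted in dim ≥ 3. [cite: vanGeemen1994HodgeAV, Lemma 5.2 (3)–(4) and (5.4.1)] [cite: Shimura1998, §14.3 Prop. 5, p. 104] -/
theorem det_realPart_principal_sqrtNegSeven [IsCyclotomicExtension {28} ℚ K] [IsCMField K]
    (hζ : IsPrimitiveRoot ζ 28) {ζ' : K} (hζ' : IsCMField.complexConj K ζ' = -ζ')
    (hT : CMTypeLattice.IsOfType (1 : (FractionalIdeal (𝓞 K)⁰ K)ˣ) ζ' ⊤)
    {x : Fin 6 → K} (hx : ∀ i, x i = (ζ + ζ⁻¹) ^ (i : ℕ)) {a : Matrix (Fin 6) (Fin 6) ℚ}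
    (ha : ∀ i j, a i j = Algebra.trace ℚ K (ζ' * x i * IsCMField.complexConj K ((1 + 2 * (ζ ^ 4 + ζ ^ 8 + ζ ^ 16)) * x j))) :
    a.det = 21952 := by
  obtain ⟨ωb, hωb⟩ := exists_basis_thetaPow hζ
  have hx' : ∀ i, x i = (ωb i : K) := fun i => (hx i).trans (hωb i).symm
  rw [det_realPart_eq_of_isOfType ωb (complexConj_sqrtNegSeven hζ) hx' (norm_realUnits_pos_twentyEight hζ)
    (complexConj_xi_twentyEight hζ) (xi_ne_zero hζ 5) hζ' (isOfType_one_xi_top hζ 5) hT (fun i j => rfl) ha]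
  exact det_realPart_xi_sqrtNegSeven hζ hx (fun i j => rfl)

open scoped Classical in
/-- **NO principal-type `E_ζ′` on `ℤ[ζ_28]` is `Φ`-positive on a `ℚ(√−7)`-signature-`(3,3)` CM type** (`s = √−7 = 1 + 2(ζ⁴ + ζ⁸ + ζ¹⁶)`):
`det a = 21952 > 0` for every skew principal-type `ζ′` (above), while van Geemen's sign would force `0 < (−1)³ det a`
(part 92 `not_pos_of_neg_one_pow_mul_det_nonpos`) — the census NO row `(28, ℚ(√−7))` (b01.34, THEOREM L there via
unit signatures) RE-DERIVED from a determinant sign.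
research route conditional on HC_CM; not a corollary; Q11.4-sentence-2 already refuted in dim ≥ 3. [cite: vanGeemen1994HodgeAV, Lemma 5.2 (4)] [cite: Shimura1998, §14.3 Prop. 4–5, pp. 103–104] -/
theorem not_pos_of_principal_sqrtNegSeven [IsCyclotomicExtension {28} ℚ K] [IsCMField K] (hζ : IsPrimitiveRoot ζ 28)
    (Φ : CMType K)
    (hneg : (Finset.univ.filter fun φ : Φ.1 => (φ.1 (1 + 2 * (ζ ^ 4 + ζ ^ 8 + ζ ^ 16))).im < 0).card = 3)
    (hposc : (Finset.univ.filter fun φ : Φ.1 => 0 < (φ.1 (1 + 2 * (ζ ^ 4 + ζ ^ 8 + ζ ^ 16))).im).card = 3)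
    {ζ' : K} (hζ' : IsCMField.complexConj K ζ' = -ζ')
    (hT : CMTypeLattice.IsOfType (1 : (FractionalIdeal (𝓞 K)⁰ K)ˣ) ζ' ⊤) :
    ¬ ∀ φ : Φ.1, 0 < (φ.1 ζ').im := by
  obtain ⟨ωb, hωb⟩ := exists_basis_thetaPow hζ
  have hs := complexConj_sqrtNegSeven hζ
  have hs0 : ((1 + 2 * (ζ ^ 4 + ζ ^ 8 + ζ ^ 16)) : K) ≠ 0 := fun h => by
    have h2 := sq_sqrtNegSeven hζ
    rw [h] at h2
    norm_num at h2
  obtain ⟨γ₀, hγ⟩ := exists_real_eq_mul_of_skew hζ' hs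
  set A : Matrix (Fin 6) (Fin 6) ℚ := Matrix.of fun i j => Algebra.trace ℚ K (ζ' * (ωb i : K) *
      IsCMField.complexConj K ((1 + 2 * (ζ ^ 4 + ζ ^ 8 + ζ ^ 16)) * (ωb j : K))) with hA
  have hA' : ∀ i j, A i j = Algebra.trace ℚ K (ζ' * (ωb i : K) *
      IsCMField.complexConj K ((1 + 2 * (ζ ^ 4 + ζ ^ 8 + ζ ^ 16)) * (ωb j : K))) := fun i j => rfl
  have hdet := det_realPart_principal_sqrtNegSeven hζ hζ' hT (x := fun i => (ωb i : K)) hωb hA'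
  have hζ'0 : ζ' ≠ 0 := by
    intro h0
    have hzero : A = 0 := by
      ext i j
      simp [hA, h0]
    rw [hzero, Matrix.det_zero] at hdet
    norm_num at hdet
  exact not_pos_of_neg_one_pow_mul_det_nonpos Φ ωb hζ' hs hs0 hζ'0 hneg hposc (fun i => rfl) hγ hA'
    (by rw [hdet]; norm_num)

end Summit.HodgeConjecture.Ring2WeilCoverage.WeilGramLevel28SqrtNegSeven

end
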